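import Summits.Ventures.YMGap.RobustBall.Targets
import HarnessLib

/-!
# RobustBall/FineBall — the READS-INCIDENCE torus ball (track Y2, optional upgrade layer v0.3; rb-theory 2026-08-22)

HONEST FRAMING: DEFINITIONS, comparison lemmas and TARGET SHAPES only — strong-coupling LATTICE statements about an
explicit neighbourhood of the Wilson action; nothing about the continuum limit or a Clay-sense mass gap.

WHY THIS FILE (p1 g6 finding 2026-08-22T20:29Z, rb-theory rulings 20:34Z / 20:54Z). In the landed `RobustBall/Defs`
the index set `polymersThroughEdge e` of every load is the set of site sets `X` with `e ∈ polymerEdges 1 X`, i.e.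
containing the BASE SITE `e.1`; so `LoadWitness.crossLip` charges a polymer to every link based at one of its sites,
whether or not its activity reads that link (SITE INCIDENCE). The gate is append-only, so that convention is the one
of record for `ClusterDomainFR` / `ClusterDomain` and every door proved on them. This file adds, under NEW names, the
READS-INCIDENCE ball designed in `HOME/rb/ROBUST-BALL-DESIGN.md` §2: a polymer is charged to the link `e` only if
its activity READS `e` (`Reads W X e`: changing the link `e` alone can change `W_X`). Polymers through the site `e.1`
that ignore `e` contribute `g`-constants to the one-link reweighting and cancel in the tilted one-link law
(`not_reads_iff`), so the single-link door goes through verbatim for the larger ball (ds-2 g6 holds that proof in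
scratch S8). CONTENT: `Reads`, `polymersReading ⊆ polymersThroughEdge`, the reads-incidence loads
`oscLoadF / selfLipLoadF / crossLipF / crossLipLoadF ≤` their site-incidence namesakes, the balls `InBallFine`,
`ClusterDomainFRFine ⊇ ClusterDomainFR`, `ClusterDomainFine ⊇ ClusterDomain` (`mem_fine_of_mem`), the conclusion
predicates on the fine ball with the one-line implications «fine-ball theorem ⇒ landed-ball theorem», and the
member / witness targets with the READS-INCIDENCE loads (`8(d−1)λ`, `36(d−1)|τ|/√N`, `32(d−1)(d−2)|τ|/√N` — the numbers
of the v0.2 targets, which are provable for THIS ball and not for the landed one). Nobody blocks on this file: the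
landed ball's rows, currencies and `(β⋆, ε)` are unchanged; only NAMED-ACTION windows on the torus grow by `≤ ×d`.
-/

noncomputable section

open MeasureTheory ProbabilityTheory Finset Function
open scoped NNReal
open Literature.Probability.LatticeModels Literature.Probability.LatticeModels.DobrushinMetric
open Literature.MathematicalPhysics.QuantumLattice hiding torusNorm
open Literature.MathematicalPhysics.QuantumFieldTheory hiding ZdEdge

namespace Summit.Ventures.YMGap.RobustBall

variable {d L N : ℕ} [NeZero L]

/-! ### Reads incidence -/

/-- `W_X` READS the link `e`: changing the link `e` alone can change `W_X` (genuine dependence — the carrier field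
`dependsOn'` only bounds the dependence by the site-incidence link set `polymerEdges 1 X`). [folklore] -/
def Reads (W : Perturbation d L N) (X : Finset (Site d L)) (e : Edge d L) : Prop :=
  ∃ (U : GaugeConfig d L (SUN N)) (g : SUN N), W.act X (Function.update U e g) ≠ W.act X U

/-- `W_X` does not read `e` iff it is invariant under every change of the link `e` alone. [folklore] -/
theorem not_reads_iff {W : Perturbation d L N} {X : Finset (Site d L)} {e : Edge d L} :
    ¬ Reads W X e ↔
      ∀ (U : GaugeConfig d L (SUN N)) (g : SUN N), W.act X (Function.update U e g) = W.act X U := by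
  simp [Reads]

/-- The zero perturbation reads no link. [folklore] -/
theorem not_reads_zero (X : Finset (Site d L)) (e : Edge d L) : ¬ Reads (0 : Perturbation d L N) X e :=
  not_reads_iff.2 fun _ _ => rfl

/-- A polymer reads only links of its site-incidence link set (`dependsOn'`). [folklore] -/
theorem mem_polymerEdges_of_reads {W : Perturbation d L N} {X : Finset (Site d L)} {e : Edge d L}
    (h : Reads W X e) : e ∈ polymerEdges 1 X := by
  by_contra he
  obtain ⟨U, g, hne⟩ := h
  exact hne (W.dependsOn' X (fun i hi => by
    have : i ≠ e := fun h' => he (h' ▸ hi)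
    simp [Function.update_of_ne this]))

open Classical in
/-- The polymers through `e` whose activity READS `e` (reads incidence): the index set of every fine load. [folklore] -/
def polymersReading (W : Perturbation d L N) (e : Edge d L) : Finset (Finset (Site d L)) :=
  (polymersThroughEdge e).filter fun X => Reads W X e

/-- The reads-incidence index set is contained in the site-incidence one. [folklore] -/
theorem polymersReading_subset (W : Perturbation d L N) (e : Edge d L) :
    polymersReading W e ⊆ polymersThroughEdge e := by
  classical
  exact Finset.filter_subset _ _

/-- Membership in the reads-incidence index set. [folklore] -/
theorem mem_polymersReading_iff {W : Perturbation d L N} {e : Edge d L} {X : Finset (Site d L)} :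
    X ∈ polymersReading W e ↔ X ∈ polymersThroughEdge e ∧ Reads W X e := by
  classical
  simp [polymersReading]

/-- The zero perturbation has empty reads-incidence index sets (so all its fine loads vanish). [folklore] -/
@[simp] theorem polymersReading_zero (e : Edge d L) : polymersReading (0 : Perturbation d L N) e = ∅ := by
  classical
  simp [polymersReading, not_reads_zero]

/-! ### Reads-incidence loads and their comparison with the landed (site-incidence) loads -/

namespace LoadWitness

variable {W : Perturbation d L N} (w : LoadWitness W)

/-- Reads-incidence weighted OSCILLATION LOAD at `e`: `∑_{X reads e} e^{κ diam X} osc_e(W_X)`. [folklore] -/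
def oscLoadF (κ : ℝ) (e : Edge d L) : ℝ :=
  ∑ X ∈ polymersReading W e, Real.exp (κ * polymerDiam X) * w.osc X e

/-- Reads-incidence weighted SELF-LIPSCHITZ LOAD at `e`: `∑_{X reads e} e^{κ diam X} Lip_e(W_X)`. [folklore] -/
def selfLipLoadF (κ : ℝ) (e : Edge d L) : ℝ :=
  ∑ X ∈ polymersReading W e, Real.exp (κ * polymerDiam X) * w.lip X e

open Classical in
/-- Reads-incidence weighted CROSS-LIPSCHITZ coefficient `∑_{X reads e and y} e^{κ diam X} Lip_y(W_X)`. [folklore] -/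
def crossLipF (κ : ℝ) (e y : Edge d L) : ℝ :=
  ∑ X ∈ (polymersReading W e).filter (fun X => Reads W X y), Real.exp (κ * polymerDiam X) * w.lip X y

/-- Reads-incidence weighted CROSS-LIPSCHITZ LOAD at `e`: `∑_{y ≠ e}` of `crossLipF`. [folklore] -/
def crossLipLoadF (κ : ℝ) (e : Edge d L) : ℝ :=
  ∑ y ∈ univ.erase e, w.crossLipF κ e y

/-- Fine oscillation load `≤` landed oscillation load (fewer nonnegative terms). [folklore] -/
theorem oscLoadF_le (κ : ℝ) (e : Edge d L) : w.oscLoadF κ e ≤ w.oscLoad κ e := by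
  classical
  unfold oscLoadF oscLoad
  exact Finset.sum_le_sum_of_subset_of_nonneg (polymersReading_subset W e)
    (fun X _ _ => mul_nonneg (Real.exp_nonneg _) ((w.osc_spec X).nonneg e))

/-- Fine self-Lipschitz load `≤` landed self-Lipschitz load. [folklore] -/
theorem selfLipLoadF_le (κ : ℝ) (e : Edge d L) : w.selfLipLoadF κ e ≤ w.selfLipLoad κ e := by
  classical
  unfold selfLipLoadF selfLipLoad
  exact Finset.sum_le_sum_of_subset_of_nonneg (polymersReading_subset W e)
    (fun X _ _ => mul_nonneg (Real.exp_nonneg _) ((w.lip_spec X).nonneg e))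

/-- Fine cross coefficient `≤` landed cross coefficient (a polymer reading `y` has `y` in its site-incidence
link set, `mem_polymerEdges_of_reads`). [folklore] -/
theorem crossLipF_le (κ : ℝ) (e y : Edge d L) : w.crossLipF κ e y ≤ w.crossLip κ e y := by
  classical
  unfold crossLipF crossLip
  refine Finset.sum_le_sum_of_subset_of_nonneg ?_
    (fun X _ _ => mul_nonneg (Real.exp_nonneg _) ((w.lip_spec X).nonneg y))
  intro X hX
  rw [Finset.mem_filter] at hX ⊢
  exact ⟨polymersReading_subset W e hX.1, mem_polymerEdges_of_reads hX.2⟩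

/-- Fine cross load `≤` landed cross load. [folklore] -/
theorem crossLipLoadF_le (κ : ℝ) (e : Edge d L) : w.crossLipLoadF κ e ≤ w.crossLipLoad κ e := by
  unfold crossLipLoadF crossLipLoad
  exact Finset.sum_le_sum fun y _ => w.crossLipF_le κ e y

/-- The fine loads of any witness vanish for the zero perturbation. [folklore] -/
theorem oscLoadF_zero (w₀ : LoadWitness (0 : Perturbation d L N)) (κ : ℝ) (e : Edge d L) :
    w₀.oscLoadF κ e = 0 := by simp [oscLoadF]

end LoadWitness

/-! ### The reads-incidence balls -/

/-- Reads-incidence PER-LINK load bounds: `a_κ(e) ≤ ε₀` and `ℓ_{s,κ}(e) + Λ_κ(e) ≤ ε₁` at every link, for some load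
witness, all loads indexed by `polymersReading`. [folklore] -/
def InBallFine (κ ε₀ ε₁ : ℝ) (W : Perturbation d L N) : Prop :=
  ∃ w : LoadWitness W, (∀ e, w.oscLoadF κ e ≤ ε₀) ∧ (∀ e, w.selfLipLoadF κ e + w.crossLipLoadF κ e ≤ ε₁)

/-- The landed (site-incidence) load bounds imply the reads-incidence ones, with the same witness. [folklore] -/
theorem inBallFine_of_inBall {κ ε₀ ε₁ : ℝ} {W : Perturbation d L N} (h : InBall κ ε₀ ε₁ W) :
    InBallFine κ ε₀ ε₁ W := by
  obtain ⟨w, h₀, h₁⟩ := h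
  refine ⟨w, fun e => (w.oscLoadF_le κ e).trans (h₀ e), fun e => ?_⟩
  exact (add_le_add (w.selfLipLoadF_le κ e) (w.crossLipLoadF_le κ e)).trans (h₁ e)

/-- **TIER 1 reads-incidence ball** `ClusterDomainFRFine ε₀ ε₁ r`: finite range `r`, fine loads `≤ (ε₀, ε₁)`. [folklore] -/
def ClusterDomainFRFine (ε₀ ε₁ : ℝ) (r : ℕ) : Set (Perturbation d L N) :=
  {W | HasRange r W ∧ InBallFine 0 ε₀ ε₁ W}

/-- **TIER 2 reads-incidence ball** `ClusterDomainFine κ ε₀ ε₁`: weighted fine loads, no range cut-off. [folklore] -/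
def ClusterDomainFine (κ ε₀ ε₁ : ℝ) : Set (Perturbation d L N) :=
  {W | InBallFine κ ε₀ ε₁ W}

/-- The landed tier-1 ball is contained in the reads-incidence tier-1 ball (so every theorem proved on the fine
ball implies its landed-ball namesake). [folklore] -/
theorem mem_fine_of_mem {ε₀ ε₁ : ℝ} {r : ℕ} {W : Perturbation d L N} (h : W ∈ ClusterDomainFR ε₀ ε₁ r) :
    W ∈ ClusterDomainFRFine ε₀ ε₁ r :=
  ⟨h.1, inBallFine_of_inBall h.2⟩

/-- The landed tier-2 ball is contained in the reads-incidence tier-2 ball. [folklore] -/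
theorem mem_fineW_of_mem {κ ε₀ ε₁ : ℝ} {W : Perturbation d L N} (h : W ∈ ClusterDomain κ ε₀ ε₁) :
    W ∈ ClusterDomainFine κ ε₀ ε₁ :=
  inBallFine_of_inBall h

/-- The zero perturbation is in every reads-incidence tier-1 ball with nonnegative radii. [folklore] -/
theorem zero_mem_clusterDomainFRFine {ε₀ ε₁ : ℝ} (h₀ : 0 ≤ ε₀) (h₁ : 0 ≤ ε₁) (r : ℕ) :
    (0 : Perturbation d L N) ∈ ClusterDomainFRFine ε₀ ε₁ r :=
  mem_fine_of_mem (zero_mem_clusterDomainFR h₀ h₁ r)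

/-- The zero perturbation is in every reads-incidence tier-2 ball with nonnegative radii. [folklore] -/
theorem zero_mem_clusterDomainFine {κ ε₀ ε₁ : ℝ} (h₀ : 0 ≤ ε₀) (h₁ : 0 ≤ ε₁) :
    (0 : Perturbation d L N) ∈ ClusterDomainFine κ ε₀ ε₁ :=
  mem_fineW_of_mem (zero_mem_clusterDomain h₀ h₁)

/-! ### Conclusion predicates on the reads-incidence ball, and «fine theorem ⇒ landed theorem» -/

/-- Robust torus Dobrushin door (tier 1) on the READS-INCIDENCE ball: same body as `RobustTorusDoor` with
`ClusterDomainFRFine`. Expected entry: the same `ρ = rhoFR N c_W ε₀ ε₁` (the `g`-constancy step, `not_reads_iff`). [folklore] -/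
def RobustTorusDoorFine (N d : ℕ) (β ε₀ ε₁ : ℝ) (r : ℕ) (ρ : ℝ) : Prop :=
  ∀ (L : ℕ) [NeZero L], 3 ≤ L → ∀ W : Perturbation d L N, W ∈ ClusterDomainFRFine ε₀ ε₁ r →
    ∃ (nbr : Edge d L → Finset (Edge d L)) (C : Edge d L → Edge d L → ℝ),
      IsKRContraction (perturbedTorusSpec W β) suFrobDist nbr C ∧
        (∀ e, ∑ y ∈ nbr e, C e y ≤ ρ) ∧ (∀ e, ∀ y ∈ nbr e, torusNorm (e.1 - y.1) ≤ max r 1)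

/-- A fine-ball door is a landed-ball door. [folklore] -/
theorem robustTorusDoor_of_fine {N d : ℕ} {β ε₀ ε₁ : ℝ} {r : ℕ} {ρ : ℝ}
    (h : RobustTorusDoorFine N d β ε₀ ε₁ r ρ) : RobustTorusDoor N d β ε₀ ε₁ r ρ :=
  fun L _ hL W hW => h L hL W (mem_fine_of_mem hW)

/-- Torus-uniform exponential clustering on the READS-INCIDENCE tier-1 ball. [folklore] -/
def TorusClusteringOnBallFine (N d : ℕ) (β ε₀ ε₁ : ℝ) (r : ℕ) (A m : ℝ) : Prop :=
  ∀ (L : ℕ) [NeZero L], 3 ≤ L → ∀ W : Perturbation d L N, W ∈ ClusterDomainFRFine ε₀ ε₁ r → ClustersWith W β A m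

/-- Fine-ball clustering is landed-ball clustering. [folklore] -/
theorem torusClusteringOnBall_of_fine {N d : ℕ} {β ε₀ ε₁ : ℝ} {r : ℕ} {A m : ℝ}
    (h : TorusClusteringOnBallFine N d β ε₀ ε₁ r A m) : TorusClusteringOnBall N d β ε₀ ε₁ r A m :=
  fun L _ hL W hW => h L hL W (mem_fine_of_mem hW)

/-- Torus-uniform exponential clustering on the READS-INCIDENCE tier-2 ball. [folklore] -/
def TorusClusteringOnBallWFine (N d : ℕ) (β κ ε₀ ε₁ : ℝ) (A m : ℝ) : Prop :=
  ∀ (L : ℕ) [NeZero L], 3 ≤ L → ∀ W : Perturbation d L N, W ∈ ClusterDomainFine κ ε₀ ε₁ → ClustersWith W β A m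

/-- Fine tier-2 clustering is landed tier-2 clustering. [folklore] -/
theorem torusClusteringOnBallW_of_fine {N d : ℕ} {β κ ε₀ ε₁ : ℝ} {A m : ℝ}
    (h : TorusClusteringOnBallWFine N d β κ ε₀ ε₁ A m) : TorusClusteringOnBallW N d β κ ε₀ ε₁ A m :=
  fun L _ hL W hW => h L hL W (mem_fineW_of_mem hW)

/-- Area law on the READS-INCIDENCE ball (same body as `AreaLawOnBall` with `ClusterDomainFRFine`). [folklore] -/
def AreaLawOnBallFine (N d : ℕ) (β ε₀ ε₁ : ℝ) (r mv : ℕ) : Prop :=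
  ∃ C c : ℝ, 0 < c ∧ ∀ (L : ℕ) [NeZero L] (W : Perturbation d L N), W ∈ ClusterDomainFRFine ε₀ ε₁ r →
    IsSlabLocal mv W → ∀ (x : Site d L) (i j : Fin d) (R T : ℕ), i ≠ j → 1 ≤ R → 1 ≤ T →
      2 * R ≤ L → 2 * T ≤ L →
        |W.expectation (fundamentalRep (Fin N)) β (wilsonLoop (fundamentalRep (Fin N)) x i j R T)| ≤
          C ^ (2 * (R + T)) * Real.exp (-c * (R * T))

/-- A fine-ball area law is a landed-ball area law. [folklore] -/
theorem areaLawOnBall_of_fine {N d : ℕ} {β ε₀ ε₁ : ℝ} {r mv : ℕ}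
    (h : AreaLawOnBallFine N d β ε₀ ε₁ r mv) : AreaLawOnBall N d β ε₀ ε₁ r mv := by
  obtain ⟨C, c, hc, h⟩ := h
  exact ⟨C, c, hc, fun L _ W hW => h L W (mem_fine_of_mem hW)⟩

/-! ### Member / witness targets with the READS-INCIDENCE loads (the v0.2 numbers, provable for THIS ball) -/

/-- PLAQUETTE-CLASS-FUNCTION MEMBER of the reads-incidence ball: loads `2(d−1)a₀`, `8(d−1)λ`, range `1`. [folklore] -/
def PlaquetteMemberFineTarget (N d : ℕ) : Prop :=
  ∀ (f : SUN N → ℝ) (a₀ lam : ℝ), Continuous f → (∀ g h : SUN N, f (h * g * h⁻¹) = f g) →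
    (∀ x y, f x - f y ≤ a₀) → (∀ x y, |f x - f y| ≤ lam * suFrobDist x y) →
    ∀ (L : ℕ) [NeZero L], 3 ≤ L → ∃ W : Perturbation d L N,
      IsPlaquetteAction f W ∧ IsPlaquetteLocal W ∧
        W ∈ ClusterDomainFRFine (2 * ((d : ℝ) - 1) * a₀) (8 * ((d : ℝ) - 1) * lam) 1 ∧
        HasVertRange 1 W ∧ IsSlabLocal 1 W

/-- RECTANGLE WITNESS (w1) in the reads-incidence ball: loads `12(d−1)|τ|`, `36(d−1)|τ|/√N`, range `2`. [folklore] -/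
def RectangleWitnessFineTarget (N d : ℕ) : Prop :=
  ∀ (τ : ℝ) (L : ℕ) [NeZero L], 3 ≤ L → ∃ W : Perturbation d L N,
    (∀ U, W.total U =
        ∑ x : Site d L, ∑ i : Fin d, ∑ j : Fin d, if i = j then 0 else rectangleActivity N τ x i j U) ∧
      W ∈ ClusterDomainFRFine (12 * ((d : ℝ) - 1) * |τ|) (36 * ((d : ℝ) - 1) * |τ| / Real.sqrt N) 2 ∧
      HasVertRange 2 W ∧ IsSlabLocal 2 W

/-- PARALLEL-PAIR WITNESS (w3) in the reads-incidence ball: loads `8(d−1)(d−2)|τ|`, `32(d−1)(d−2)|τ|/√N`,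
range `2`. [folklore] -/
def ParallelPairWitnessFineTarget (N d : ℕ) : Prop :=
  ∀ (τ : ℝ) (L : ℕ) [NeZero L], 3 ≤ L → ∃ W : Perturbation d L N,
    (∀ U, W.total U = ∑ x : Site d L, ∑ i : Fin d, ∑ j : Fin d, ∑ k : Fin d,
        if i < j ∧ k ≠ i ∧ k ≠ j then parallelPairActivity N τ x i j k U else 0) ∧
      W ∈ ClusterDomainFRFine (8 * ((d : ℝ) - 1) * ((d : ℝ) - 2) * |τ|)
          (32 * ((d : ℝ) - 1) * ((d : ℝ) - 2) * |τ| / Real.sqrt N) 2 ∧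
      HasVertRange 2 W ∧ IsSlabLocal 2 W

end Summit.Ventures.YMGap.RobustBall
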